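import Mathlib
import HarnessLib

/-!
# Collatz–Wielandt upper bound: `A ≥ 0`, `x ≫ 0`, `A x ≤ β x` ⇒ every eigenvalue has `|μ| ≤ β`

Topic `Literature/LinearAlgebra/Matrix`; support file (everything PROVED; no definitions; no named
facts).

Berman–Plemmons, Ch. 2, Thm. (1.11), second implication: for a nonnegative square matrix `A`,
`A x ≤ β x` with `x ≫ 0` implies `ρ(A) ≤ β` (the sub-invariance / Collatz quotient bound
`ρ(A) ≤ maxᵢ (A x)ᵢ / xᵢ`; Collatz 1942, Wielandt 1950). Typed here WITHOUT Perron–Frobenius, by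
the weighted Gershgorin-type argument at an index maximising `‖vᵢ‖ / xᵢ`, and in the slightly
more general DOMINATED form (Wielandt's comparison `ρ(B) ≤ ρ(|B|) ≤ ρ(A)` for `|B| ≤ A`, weak
half): if `B` is a matrix over a normed field with `‖bᵢⱼ‖ ≤ aᵢⱼ`, `x ≫ 0` and `A x ≤ β x`, then
every eigenpair `B v = μ v`, `v ≠ 0`, has `‖μ‖ ≤ β`:
* `norm_eigenvalue_le_of_dominated_of_mulVec_le` (eigen-equation form, `B` dominated by `A`);
* `norm_eigenvalue_le_of_nonneg_of_mulVec_le` (`B = A` itself, read in a normed `ℝ`-algebra);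
* `norm_le_of_hasEigenvalue_toLin'_of_dominated` (`Module.End.HasEigenvalue` form),
  `norm_le_of_mem_spectrum_toLin'_of_dominated` (spectrum form) and
  `spectralRadius_toLin'_le_of_dominated` (`spectralRadius K (toLin' B) ≤ β`).

NOT TYPED here: the lower half `α x ≤ A x, x > 0, x ≠ 0 ⇒ α ≤ ρ(A)` and the strict / irreducible
refinements of Thm. (1.11) (they need the Perron–Frobenius eigenvector), `max`/`min` forms of
the Collatz–Wielandt function.

References:
* A. Berman, R. J. Plemmons, *Nonnegative Matrices in the Mathematical Sciences*, Academic Press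
  1979 = SIAM Classics 9 (1994), Ch. 2, Thm. (1.11) and Notes (7.5) (Collatz–Wielandt function);
  Ch. 2, Thm. (2.14) (Wielandt: `|B| ≤ A ⇒ ρ(B) ≤ ρ(A)`). Held 1979 edition
  `book:berman1979-nonnegative-matrices-mathematical-sciences`, PDF p. 27 and p. 50.
  [BermanPlemmons1994]
-/

namespace Literature.LinearAlgebra.Matrix

open scoped _root_.Matrix _root_.ENNReal
open Finset _root_.Matrix

variable {n : Type*} [Fintype n] {K : Type*} [NormedField K]

/-- **Collatz–Wielandt upper bound, dominated eigen-equation form**: if `‖B i j‖ ≤ A i j` for all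
`i, j`, `x ≫ 0` and `(A x)ᵢ ≤ β xᵢ` for all `i`, then every solution of `B v = μ v` with `v ≠ 0`
has `‖μ‖ ≤ β`. Proof: at an index `i₀` maximising `‖vᵢ‖ / xᵢ =: t > 0`, row `i₀` of the
eigen-equation gives `‖μ‖ t x_{i₀} = ‖μ v_{i₀}‖ ≤ Σⱼ aᵢ₀ⱼ ‖vⱼ‖ ≤ t (A x)_{i₀} ≤ t β x_{i₀}`.
[cite: BermanPlemmons1994, Ch. 2, Thm. (1.11) and Thm. (2.14)] -/
theorem norm_eigenvalue_le_of_dominated_of_mulVec_le {B : Matrix n n K} {A : Matrix n n ℝ}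
    (hBA : ∀ i j, ‖B i j‖ ≤ A i j) {x : n → ℝ} (hx : ∀ i, 0 < x i) {β : ℝ}
    (hβ : ∀ i, (A *ᵥ x) i ≤ β * x i) {μ : K} {v : n → K} (hv : v ≠ 0) (h : B *ᵥ v = μ • v) :
    ‖μ‖ ≤ β := by
  obtain ⟨j₀, hj₀⟩ := Function.ne_iff.1 hv
  obtain ⟨i₀, -, hmax⟩ :=
    Finset.exists_max_image Finset.univ (fun i => ‖v i‖ / x i) ⟨j₀, Finset.mem_univ j₀⟩
  set t : ℝ := ‖v i₀‖ / x i₀ with ht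
  have hle : ∀ j, ‖v j‖ ≤ t * x j := fun j =>
    (div_le_iff₀ (hx j)).1 (hmax j (Finset.mem_univ j))
  have htpos : 0 < t :=
    (div_pos (norm_pos_iff.2 hj₀) (hx j₀)).trans_le (hmax j₀ (Finset.mem_univ j₀))
  have hrow : μ * v i₀ = ∑ j, B i₀ j * v j := by
    have h1 := congrFun h i₀
    simp only [mulVec, dotProduct, Pi.smul_apply, smul_eq_mul] at h1
    exact h1.symm
  have key : ‖μ‖ * (t * x i₀) ≤ β * (t * x i₀) :=
    calc ‖μ‖ * (t * x i₀) = ‖μ‖ * ‖v i₀‖ := by rw [ht, div_mul_cancel₀ _ (hx i₀).ne']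
      _ = ‖∑ j, B i₀ j * v j‖ := by rw [← norm_mul, hrow]
      _ ≤ ∑ j, ‖B i₀ j‖ * ‖v j‖ :=
          (norm_sum_le _ _).trans (le_of_eq (sum_congr rfl fun j _ => norm_mul _ _))
      _ ≤ ∑ j, A i₀ j * (t * x j) :=
          sum_le_sum fun j _ =>
            mul_le_mul (hBA _ _) (hle j) (norm_nonneg _) ((norm_nonneg _).trans (hBA _ _))
      _ = t * (A *ᵥ x) i₀ := by
          simp only [mulVec, dotProduct, mul_sum]
          exact sum_congr rfl fun j _ => by ring
      _ ≤ t * (β * x i₀) := mul_le_mul_of_nonneg_left (hβ i₀) htpos.le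
      _ = β * (t * x i₀) := by ring
  exact le_of_mul_le_mul_right key (mul_pos htpos (hx i₀))

/-- **Collatz–Wielandt upper bound for a nonnegative matrix** (`B = A` read in a normed
`ℝ`-algebra `K`, e.g. `ℝ` or `ℂ`): if `A ≥ 0`, `x ≫ 0` and `A x ≤ β x`, then every eigenpair
`A v = μ v` (`v ≠ 0`, over `K`) has `‖μ‖ ≤ β`; i.e. `ρ(A) ≤ maxᵢ (A x)ᵢ / xᵢ`.
[cite: BermanPlemmons1994, Ch. 2, Thm. (1.11)] -/
theorem norm_eigenvalue_le_of_nonneg_of_mulVec_le [NormedAlgebra ℝ K] {A : Matrix n n ℝ}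
    (hA : ∀ i j, 0 ≤ A i j) {x : n → ℝ} (hx : ∀ i, 0 < x i) {β : ℝ}
    (hβ : ∀ i, (A *ᵥ x) i ≤ β * x i) {μ : K} {v : n → K} (hv : v ≠ 0)
    (h : (A.map (algebraMap ℝ K)) *ᵥ v = μ • v) : ‖μ‖ ≤ β :=
  norm_eigenvalue_le_of_dominated_of_mulVec_le (B := A.map (algebraMap ℝ K)) (fun i j => by
    rw [map_apply, norm_algebraMap', Real.norm_of_nonneg (hA i j)]) hx hβ hv h

section ToLin

variable [DecidableEq n]

/-- `Module.End.HasEigenvalue` form of the dominated bound: every eigenvalue `μ` of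
`Matrix.toLin' B` (`‖bᵢⱼ‖ ≤ aᵢⱼ`, `x ≫ 0`, `A x ≤ β x`) has `‖μ‖ ≤ β`.
[cite: BermanPlemmons1994, Ch. 2, Thm. (1.11) and Thm. (2.14)] -/
theorem norm_le_of_hasEigenvalue_toLin'_of_dominated {B : Matrix n n K} {A : Matrix n n ℝ}
    (hBA : ∀ i j, ‖B i j‖ ≤ A i j) {x : n → ℝ} (hx : ∀ i, 0 < x i) {β : ℝ}
    (hβ : ∀ i, (A *ᵥ x) i ≤ β * x i) {μ : K}
    (hμ : Module.End.HasEigenvalue (Matrix.toLin' B) μ) : ‖μ‖ ≤ β := by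
  obtain ⟨v, hv⟩ := hμ.exists_hasEigenvector
  have h := hv.apply_eq_smul
  rw [Matrix.toLin'_apply] at h
  exact norm_eigenvalue_le_of_dominated_of_mulVec_le hBA hx hβ hv.2 h

/-- Spectrum form: every `μ ∈ spectrum K (Matrix.toLin' B)` has `‖μ‖ ≤ β` (finite dimension:
the spectrum of `toLin' B` consists of its eigenvalues).
[cite: BermanPlemmons1994, Ch. 2, Thm. (1.11) and Thm. (2.14)] -/
theorem norm_le_of_mem_spectrum_toLin'_of_dominated {B : Matrix n n K} {A : Matrix n n ℝ}
    (hBA : ∀ i j, ‖B i j‖ ≤ A i j) {x : n → ℝ} (hx : ∀ i, 0 < x i) {β : ℝ}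
    (hβ : ∀ i, (A *ᵥ x) i ≤ β * x i) {μ : K} (hμ : μ ∈ spectrum K (Matrix.toLin' B)) :
    ‖μ‖ ≤ β :=
  norm_le_of_hasEigenvalue_toLin'_of_dominated hBA hx hβ
    (Module.End.hasEigenvalue_iff_mem_spectrum.2 hμ)

/-- **`ρ(B) ≤ β`**: the spectral radius of `Matrix.toLin' B` over `K` is at most `β` whenever
`‖bᵢⱼ‖ ≤ aᵢⱼ`, `x ≫ 0` and `A x ≤ β x` (Berman–Plemmons Thm. 2.1.11 with Wielandt's comparison,
weak form). [cite: BermanPlemmons1994, Ch. 2, Thm. (1.11) and Thm. (2.14)] -/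
theorem spectralRadius_toLin'_le_of_dominated {B : Matrix n n K} {A : Matrix n n ℝ}
    (hBA : ∀ i j, ‖B i j‖ ≤ A i j) {x : n → ℝ} (hx : ∀ i, 0 < x i) {β : ℝ}
    (hβ : ∀ i, (A *ᵥ x) i ≤ β * x i) :
    spectralRadius K (Matrix.toLin' B) ≤ ENNReal.ofReal β := by
  refine iSup₂_le fun μ hμ => ?_
  have h := norm_le_of_mem_spectrum_toLin'_of_dominated hBA hx hβ hμ
  have hβ0 : 0 ≤ β := (norm_nonneg μ).trans h
  change ((‖μ‖₊ : NNReal) : ℝ≥0∞) ≤ ((Real.toNNReal β : NNReal) : ℝ≥0∞)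
  exact ENNReal.coe_le_coe.2 ((Real.le_toNNReal_iff_coe_le hβ0).2 h)

end ToLin

end Literature.LinearAlgebra.Matrix
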